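import Summits.HodgeConjecture.HodgeConjecture.Theorems.H413PinCharacterTransport
import Summits.HodgeConjecture.HodgeCM.Model.AdelicThetaDistributionFin_1
import HarnessLib

/-!
# FLOOR-0 P4, S4b row (χ) — the finite see-saw multiplier `finCharZero (1, ·)` of the line IS the J-R multiplier, hence UNITARY
# and CONTINUOUS (the `he1`, `hec` inputs of ★ `exists_chiFin_eq_mul` for `e := finCharZero (1, ·)`)

Cell hodgecm-mathlib (D-0151), FLOOR 0, crux item H413 = stmt-HodgeConjecture-24833; programme P4, line
`Cruxes/H413/Lines/F0_P4AdmissibleOccursInH1.lean` ED. 2∕2.1, stub S4b; F0P4-p01's reduction theorem ★ p797429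
`exists_holTheta_atLine_of_inputs`, row `hχ : D.chiFin χ̃ u = finCharZero (1, u) · χ₁ u` — produced by ★ p793900 `exists_chiFin_eq_mul`
from six side conditions on `e := finCharZero (1, ·)` and `χ₁`; this file discharges the two on `e` that are consequences of the J-R
transport (F0P4-p05 seat): unit norm (`he1`) and continuity (`hec`).  Author F0P4-p05 (g0).  `--supports stmt-HodgeConjecture-24833`
(helper; DEF-FREE).  Namespace `Summit.HodgeConjecture.HodgeConjecture.Cruxes.H413.RallisTransport`.

* `finCharZero_one_eq_twistMultiplier` — `finCharZero V S hGR hGR₀ hGR₁ η₀ (1, u) = η₀ (1, t♭) · χ₀ (1, e t)` at `t := finLineTorusIdeles u`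
  (`t♭ = finLineTorus u`, `e t = CMCenter (finLineTorus u) = (1_∞, u)`: ★ `cmCenter_finLineTorus`, ★ `cmLineTorusEquiv_apply`);
* **`norm_finCharZero_one_eq_one`** — `‖finCharZero (1, u)‖ = 1` (★ `norm_twistMultiplier_eq_one`: the J-R multiplier is automorphic on the
  compact `[U(1)]`); hypotheses: the side `P` with `P.ω = lineRepOf … 0`, `P.ΓU = regimeRat`, and the continuity `hc` of the multiplier;
* **`continuous_finCharZero_one`** — `u ↦ finCharZero (1, u)` is continuous (from `hc` along ★ `finLineTorusIdeles`, continuous by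
  ★ `continuous_cmAdelicDet` ∕ `continuous_finAdelicToAdelic` ∕ `continuous_cmAdelicOneEquivRelNormOne`).

NOT here: `herat` (triviality of the FINITE multiplier on `U(⟨a₀⟩)(L⁺)` — equivalent, given automorphy of the full multiplier ★
`twist_eq_one`, to the triviality of its ARCHIMEDEAN part on rational points; this is the knob∕`η`-design of F0P4-p01, not a consequence of
the transport) and the three `χ₁` rows.  HC_CM is proved only modulo the printed citations until rung 0 closes; this file proves nothing about them.

## References (conventions only; nothing of print is asserted)
* [Godement1964] R. Godement, Sém. Bourbaki 257 (1964), §5 Thm. 4.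
* [GelbartRogawski1991] S. Gelbart, J. Rogawski, Invent. Math. 105 (1991), §3.1 Remark p. 457 L4–13.
* [Liu2021] Y. Liu, Camb. J. Math. 9 (2021), Def. 4.11 (l. 2090), proof of Prop. 4.13 (l. 2145).
-/

set_option autoImplicit false
set_option linter.dupNamespace false

noncomputable section

open _root_.MeasureTheory
open NumberField hiding relNormOneIdeles relNormOneRat probHaarRelNormOneQuot
open scoped Matrix
open Literature.NumberTheory.Automorphic Literature.NumberTheory.Automorphic.UnitaryGroup Literature.NumberTheory.Weil1964
open Literature.NumberTheory.GelbartRogawski1991 Literature.NumberTheory.GelbartRogawski1991.UnitaryDualPair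
open HodgeCM HodgeCM.Adelic HodgeCM.PerL34 HodgeCM.Model HodgeCM.Model.ArchSideTerm HodgeCM.Model.SupplyResidual
open HodgeCM.Model.ThetaDistFin

namespace Summit.HodgeConjecture.HodgeConjecture.Cruxes.H413.RallisTransport

variable {L : CMField} {ι₁ : L →+* ℂ} (V : HermSpace3 L ι₁) (hV : IsAnisotropic L V.Hm) (S : StubTree.SeesawDatum L)
variable
  (hGR : (cmSplittingDatum (L : Type) finProdFinEquiv (frameD V) (frameD_real V) (frameD_ne V) (dW S) (dW_real S) (dW_ne S)).CompatibleSplitting)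
  (hGR₀ : (cmSplittingDatum (L : Type) (e₁) (frameD V) (frameD_real V) (frameD_ne V) (lineVec (L : Type) (dW S 0))
    (fun _ => dW_real S 0) (fun _ => dW_ne S 0)).CompatibleSplitting)
  (hGR₁ : (cmSplittingDatum (L : Type) (e₁) (frameD V) (frameD_real V) (frameD_ne V) (lineVec (L : Type) (dW S 1))
    (fun _ => dW_real S 1) (fun _ => dW_ne S 1)).CompatibleSplitting)
  (hGR₂ : (cmSplittingDatum (L : Type) (e₁) (frameD V) (frameD_real V) (frameD_ne V) (lineVec (L : Type) (dW' S 0))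
    (fun _ => dW'_real S 0) (fun _ => dW'_ne S 0)).CompatibleSplitting)
  (hGR₃ : (cmSplittingDatum (L : Type) (e₁) (frameD V) (frameD_real V) (frameD_ne V) (lineVec (L : Type) (dW' S 1))
    (fun _ => dW'_real S 1) (fun _ => dW'_ne S 1)).CompatibleSplitting)
  (η₀ η₁ η₂ η₃ : CMAdelic (L : Type) (frameD V) × CMAdelicOne (L : Type) →* ℂˣ)

/-- **`finCharZero (1, u)` IS the J-R multiplier at `t := finLineTorusIdeles u`**: `= η₀(1, t♭) · χ₀(1, cmLineTorusEquiv t)`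
(`t♭ = finLineTorus u`, `cmLineTorusEquiv t = CMCenter (finLineTorus u) = (1_∞, u)`). [cite: GelbartRogawski1991, §3.1 Remark p. 457 L4–13] -/
theorem finCharZero_one_eq_twistMultiplier (u : UfZero S) :
    finCharZero V S hGR hGR₀ hGR₁ η₀ (1, u) =
      η₀ (1, (cmAdelicOneEquivRelNormOne (L : Type)).symm (finLineTorusIdeles (L : Type) (dW S 0) (dW_ne S 0) u)) *
        cmLineChar₀ (L : Type) finProdFinEquiv e₁ (frameD V) (frameD_real V) (frameD_ne V) (dW S) (dW_real S) (dW_ne S) hGR hGR₀ hGR₁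
          (1, cmLineTorusEquiv (L : Type) (dW S 0) (dW_ne S 0) (finLineTorusIdeles (L : Type) (dW S 0) (dW_ne S 0) u)) := by
  rw [finCharZero_apply, finPairD_apply, map_one, map_one, cmAdelicOneEquivRelNormOne_symm_finLineTorusIdeles,
    cmLineTorusEquiv_apply, cmAdelicOneEquivRelNormOne_symm_finLineTorusIdeles, cmCenter_finLineTorus]
  rfl

variable (P : WeilPairData (↥(maximalRealSubfield L)) (L : Type) (Fin 3) ↥(regimeSubgroup L V.Hm))
  (hPω : P.ω = lineRepOf V S hGR hGR₀ hGR₁ hGR₂ hGR₃ η₀ η₁ η₂ η₃ 0) (hPΓ : P.ΓU = regimeRat L V.Hm)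
  (hc : Continuous fun t : ↥(relNormOneIdeles (↥(maximalRealSubfield L)) L) =>
    ((η₀ (1, (cmAdelicOneEquivRelNormOne (L : Type)).symm t) *
        cmLineChar₀ (L : Type) finProdFinEquiv e₁ (frameD V) (frameD_real V) (frameD_ne V) (dW S) (dW_real S) (dW_ne S)
          hGR hGR₀ hGR₁ (1, cmLineTorusEquiv (L : Type) (dW S 0) (dW_ne S 0) t) : ℂˣ) : ℂ))

include hV hPω hPΓ hc in
/-- **`he1` — THE FINITE SEE-SAW MULTIPLIER IS UNITARY**: `‖finCharZero (1, u)‖ = 1` for every `u ∈ U(⟨a₀⟩)(𝔸_{L⁺,f})`.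
[cite: Godement1964, §5 Thm. 4; GelbartRogawski1991, §3.1 Remark p. 457 L4–13] -/
theorem norm_finCharZero_one_eq_one (u : UfZero S) : ‖((finCharZero V S hGR hGR₀ hGR₁ η₀ (1, u) : ℂˣ) : ℂ)‖ = 1 := by
  rw [finCharZero_one_eq_twistMultiplier]
  exact norm_twistMultiplier_eq_one V hV S hGR hGR₀ hGR₁ hGR₂ hGR₃ η₀ η₁ η₂ η₃ P hPω hPΓ hc _

omit η₁ η₂ η₃ in
include hc in
/-- **`hec` — THE FINITE SEE-SAW MULTIPLIER IS CONTINUOUS** in `u` (`finLineTorusIdeles` is continuous and the multiplier is `hc`-continuous).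
[cite: GelbartRogawski1991, §3.1 Remark p. 457 L4–13] -/
theorem continuous_finCharZero_one : Continuous fun u : UfZero S => ((finCharZero V S hGR hGR₀ hGR₁ η₀ (1, u) : ℂˣ) : ℂ) := by
  have hf : Continuous (finLineTorusIdeles (L : Type) (dW S 0) (dW_ne S 0)) :=
    (continuous_cmAdelicOneEquivRelNormOne (L : Type)).comp
      ((continuous_cmAdelicDet (L : Type) (lineVec (L : Type) (dW S 0)) fun _ => dW_ne S 0).comp
        (UnitaryGroup.continuous_finAdelicToAdelic _ _ _ _ _))
  simp_rw [finCharZero_one_eq_twistMultiplier]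
  exact hc.comp hf

end Summit.HodgeConjecture.HodgeConjecture.Cruxes.H413.RallisTransport
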